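import Summits.AnomalousDissipation.AnomalousDissipation.Theorems.MarginalStabilityChainStrainedLayerLawClockLine

/-!
# Crux `MarginalStabilityChain.StrainedLayerLaw` (stmt-AnomalousDissipation-3007), line `FirstLemmasR2K4`
# (log-enstrophy clock + Nash roundness): the CONDITIONAL composition

Support file (`--supports stmt-AnomalousDissipation-3007`; registered sub-goal `StrainedLayerLaw_of_clockStubs`), companion
of `…ClockLine.lean` (objects `negMass`/`negEnstrophy`/`negPalinstrophy`, `clockTransfer`, `floorTransfer_direct`,
`ofReal_negEnstrophy_le`). The six hypotheses of `StrainedLayerLaw_of_clockStubs` are, verbatim, the statements of the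
line's registered stubs (`stub_bareClassTails` [hygiene; the sum-rule line's registered signature, so that its landed
conditional closure `bareClassTails_of_hasShearLayerTails` (p120875) applies unchanged], `stub_circulationFloor`,
`stub_levelSetNull`, `stub_negEnstrophyLaw`, `stub_negEnstrophyApriori`, `stub_roundnessFloor`), and its conclusion is the
crux BY NAME with `c = r⋆/4`. No facts are asserted: the stubs live in the lead's skeleton
(`Cruxes/StrainedLayerLaw/Lines/FirstLemmasR2K4.lean`) and in the stub files. Line lead a2, 2026-08-16.
-/

-- `Summit.<Summit>.<Problem>` is the tree's mandated summit-side namespace (CONVENTIONS §2); for this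
-- single-conjunct summit the two coincide, so the duplicate is deliberate.
set_option linter.dupNamespace false

noncomputable section

open scoped Topology ENNReal
open Filter Set Function MeasureTheory

namespace Summit.AnomalousDissipation.AnomalousDissipation.Theorems.StrainedLayerLaw.LogEnstrophyClock

open Literature.Analysis.FluidPDE Literature.Analysis.FluidPDE.StretchedLayer
open Summit.AnomalousDissipation.AnomalousDissipation.Theses.MarginalStabilityChain
open Summit.AnomalousDissipation.AnomalousDissipation.Theorems.StrainedLayerLaw.StrainWorkSumRule

/-! ## The CONDITIONAL composition (proved): the registered stub statements prove the crux BY NAME -/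

/-- **Conditional composition of the clock line (kernel-checked, sorry-free).** Hypotheses, verbatim the line's
registered stubs: (h3) hygiene — finite-dissipation members of the bare class have shear tails on compact time
intervals (the sum-rule line's `stub_bareClassTails`, same signature); (hB2) circulation floor `M₋ ≥ L` for a tailed
slice with the shear far field; (hnull) the zero set of a `C¹` plane function carries no gradient (Lebesgue-null
`{f = 0, ∇f ≠ 0}`); (hB1) the negative-enstrophy law `Ω₋′ = Ω₋ − 2νP₋` along tailed classical solutions, CONDITIONAL on
the statement of (hnull); (hA) fixed-ν a-priori facts: `Ω₋(t) ≤ B` for `t ≥ 1`, and `M₋ > 0 ⇒ Ω₋ > 0`; (hB3) the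
ROUNDNESS FLOOR: one admissible `θ` per period such that for all small `ν` every finite-dissipation, tailed member of the
class from `U_B^ν + θ` is eventually Nash-round, `(r⋆ min(L,1)/L)·M₋²P₋ ≤ Ω₋²`. Conclusion: the crux with `c = r⋆/4`:
take `ν₀, θ` from (hB3); for a class member apply `floorTransfer_direct`; under local finiteness (h3) gives tails,
`clockTransfer` (fed by hB1, hA, hB2, hB3 on `(max T₁ 1, ∞)`) gives `(r₀L²/2 − ε)T ≤ ∫ νΩ₋` eventually, and
`ofReal(νΩ₋) ≤ 2·ofReal L·D` pointwise (`ofReal_negEnstrophy_le`) turns it into the `ℝ≥0∞` floor. [folklore] -/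
theorem StrainedLayerLaw_of_clockStubs
    (h3 : ∀ (ν L : ℝ), 0 < ν → 0 < L → ∀ (θ₁ θ₂ : ℝ → ℝ → ℝ), IsAdmissible L θ₁ θ₂ →
        ∀ (u v p : ℝ → ℝ → ℝ → ℝ), InCruxClass ν L θ₁ θ₂ u v p →
          (∀ T : ℝ, 0 < T → ∫⁻ t in Ioc 0 T, layerDissipation ν L (u t) (v t) ≠ ∞) →
            ∀ a b : ℝ, 0 < a → a < b → ExpTails (Icc a b) u v)
    (hB2 : ∀ (L C k : ℝ), 0 < L → 0 < k → ∀ (u v : ℝ → ℝ → ℝ),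
        ContDiff ℝ 2 (fun q : ℝ × ℝ => u q.1 q.2) → ContDiff ℝ 2 (fun q : ℝ × ℝ => v q.1 q.2) →
        (∀ x y, u (x + L) y = u x y) → (∀ x y, v (x + L) y = v x y) →
        (∀ x, Tendsto (fun y => u x y) atTop (𝓝 (1 / 2))) →
        (∀ x, Tendsto (fun y => u x y) atBot (𝓝 (-(1 / 2)))) →
        SliceTails C k u v → L ≤ negMass L u v)
    (hnull : ∀ (f : ℝ → ℝ → ℝ), ContDiff ℝ 1 (fun q : ℝ × ℝ => f q.1 q.2) →
        volume {q : ℝ × ℝ | f q.1 q.2 = 0 ∧ (dX f q.1 q.2 ≠ 0 ∨ dY f q.1 q.2 ≠ 0)} = 0)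
    (hB1 : (∀ (f : ℝ → ℝ → ℝ), ContDiff ℝ 1 (fun q : ℝ × ℝ => f q.1 q.2) →
          volume {q : ℝ × ℝ | f q.1 q.2 = 0 ∧ (dX f q.1 q.2 ≠ 0 ∨ dY f q.1 q.2 ≠ 0)} = 0) →
        ∀ (ν L : ℝ), 0 < ν → 0 < L → ∀ (u v p : ℝ → ℝ → ℝ → ℝ),
          IsStretchedLayerNSSolutionOn (Ioi 0) ν 1 1 L u v p →
          (∀ a b : ℝ, 0 < a → a < b → ExpTails (Icc a b) u v) →
            ∀ t : ℝ, 0 < t → HasDerivAt (fun s => negEnstrophy L (u s) (v s))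
              (negEnstrophy L (u t) (v t) - 2 * ν * negPalinstrophy L (u t) (v t)) t)
    (hA : ∀ (ν L : ℝ), 0 < ν → 0 < L → ∀ (u v p : ℝ → ℝ → ℝ → ℝ),
        IsStretchedLayerNSSolutionOn (Ioi 0) ν 1 1 L u v p →
        (∀ a b : ℝ, 0 < a → a < b → ExpTails (Icc a b) u v) →
          (∃ B : ℝ, ∀ t : ℝ, 1 ≤ t → negEnstrophy L (u t) (v t) ≤ B) ∧
          (∀ t : ℝ, 0 < t → 0 < negMass L (u t) (v t) → 0 < negEnstrophy L (u t) (v t)))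
    (hB3 : ∃ r : ℝ, 0 < r ∧ ∀ L : ℝ, 0 < L → ∃ ν₀ : ℝ, 0 < ν₀ ∧ ∃ θ₁ θ₂ : ℝ → ℝ → ℝ,
        IsAdmissible L θ₁ θ₂ ∧
        ∀ ν : ℝ, 0 < ν → ν ≤ ν₀ → ∀ (u v p : ℝ → ℝ → ℝ → ℝ), InCruxClass ν L θ₁ θ₂ u v p →
          (∀ T : ℝ, 0 < T → ∫⁻ t in Ioc 0 T, layerDissipation ν L (u t) (v t) ≠ ∞) →
          (∀ a b : ℝ, 0 < a → a < b → ExpTails (Icc a b) u v) →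
            ∃ T₁ : ℝ, 0 < T₁ ∧ ∀ t : ℝ, T₁ ≤ t →
              r * min L 1 / L * negMass L (u t) (v t) ^ 2 * negPalinstrophy L (u t) (v t) ≤
                negEnstrophy L (u t) (v t) ^ 2) :
    StrainedLayerLaw := by
  obtain ⟨r, hr, hfloor⟩ := hB3
  refine ⟨r / 4, by positivity, ?_⟩
  intro L hL
  obtain ⟨ν₀, hν₀, θ₁, θ₂, hθ, hmain⟩ := hfloor L hL
  refine ⟨ν₀, hν₀, θ₁, θ₂, hθ.1, hθ.2.1, hθ.2.2.1, hθ.2.2.2.1, hθ.2.2.2.2, ?_⟩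
  intro ν hν hνle u v p
  show InCruxClass ν L θ₁ θ₂ u v p → ENNReal.ofReal (r / 4 * min L 1) ≤ meanLayerDissipation ν L u v
  intro hcl
  have hsol : IsStretchedLayerNSSolutionOn (Ioi 0) ν 1 1 L u v p := hcl.isSolution
  refine floorTransfer_direct L (r / 4 * min L 1) (fun t => layerDissipation ν L (u t) (v t)) hL ?_
  intro hfin ε hε
  have htails : ∀ a b : ℝ, 0 < a → a < b → ExpTails (Icc a b) u v :=
    h3 ν L hν hL θ₁ θ₂ hθ u v p hcl hfin
  obtain ⟨T₁, hT₁, hround⟩ := hmain ν hν hνle u v p hcl hfin htails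
  obtain ⟨⟨B, hB⟩, hpos⟩ := hA ν L hν hL u v p hsol htails
  have hderiv := hB1 hnull ν L hν hL u v p hsol htails
  -- notation for the three functionals along the solution
  set Ω : ℝ → ℝ := fun t => negEnstrophy L (u t) (v t) with hΩdef
  set P : ℝ → ℝ := fun t => negPalinstrophy L (u t) (v t) with hPdef
  set M : ℝ → ℝ := fun t => negMass L (u t) (v t) with hMdef
  set t₀ : ℝ := max T₁ 1 with ht₀
  have ht₀T : T₁ ≤ t₀ := le_max_left _ _
  have ht₀1 : (1 : ℝ) ≤ t₀ := le_max_right _ _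
  have ht₀pos : 0 < t₀ := one_pos.trans_le ht₀1
  -- the circulation floor along the solution (tails on `[t, t + 1]`)
  have hMfloor : ∀ t, 0 < t → L ≤ M t := by
    intro t ht
    obtain ⟨C, k, hk, hCk⟩ := htails t (t + 1) ht (lt_add_one t)
    have hST : SliceTails C k (u t) (v t) := (hCk t ⟨le_rfl, (lt_add_one t).le⟩).1
    have ht' : t ∈ Ioi (0 : ℝ) := ht
    exact hB2 L C k hL hk (u t) (v t) (hsol.contDiff_u ht') (hsol.contDiff_v ht') (hsol.periodic_u t ht')
      (hsol.periodic_v t ht') (by simpa using hsol.tendsto_u_atTop t ht')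
      (by simpa using hsol.tendsto_u_atBot t ht') hST
  -- the clock
  set r₀ : ℝ := r * min L 1 / L with hr₀
  have hr₀pos : 0 < r₀ := by
    rw [hr₀]; exact div_pos (mul_pos hr (lt_min hL one_pos)) hL
  have hclock := clockTransfer (ν := ν) (L := L) (r₀ := r₀) (t₀ := t₀) (C := B) (Ω := Ω) (P := P) (M := M)
    hν hL hr₀pos
    (fun t ht => hderiv t (ht₀pos.trans ht))
    (fun t ht => hpos t (ht₀pos.trans ht) (hL.trans_le (hMfloor t (ht₀pos.trans ht))))
    (fun t ht => hB t (ht₀1.trans ht.le))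
    (fun t _ => negPalinstrophy_nonneg L (u t) (v t))
    (fun t ht => hMfloor t (ht₀pos.trans ht))
    (fun t ht => by simpa [hr₀] using hround t (ht₀T.trans ht.le))
  -- continuity of `Ω` on `(0, ∞)` (from the derivative)
  have hΩcont : ContinuousOn Ω (Ioi 0) := fun t ht => (hderiv t ht).continuousAt.continuousWithinAt
  filter_upwards [hclock ε hε, eventually_ge_atTop (t₀ + 1)] with T hT hTge
  -- (1) the real floor in `ℝ≥0∞`: `ofReal (2 (LK − ε) T) ≤ ofReal (∫_{t₀+1}^T νΩ)`
  have hKL : L * (r / 4 * min L 1) = r₀ * L ^ 2 / 4 := by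
    rw [hr₀]; field_simp
  have hT0 : 0 ≤ T := by linarith
  have hstep1 : ENNReal.ofReal (2 * ((L * (r / 4 * min L 1) - ε) * T)) ≤
      ENNReal.ofReal (∫ t in (t₀ + 1)..T, ν * Ω t) := by
    apply ENNReal.ofReal_le_ofReal
    have : 2 * ((L * (r / 4 * min L 1) - ε) * T) ≤ (r₀ * L ^ 2 / 2 - ε) * T := by
      rw [hKL]; nlinarith
    exact this.trans hT
  -- (2) the interval integral as a set `lintegral`
  have hint : IntegrableOn (fun t => ν * Ω t) (Ioc (t₀ + 1) T) := by
    have hc : ContinuousOn (fun t => ν * Ω t) (Icc (t₀ + 1) T) :=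
      (continuousOn_const.mul (hΩcont.mono fun t ht => ht₀pos.trans (by linarith [ht.1])))
    exact (hc.integrableOn_compact isCompact_Icc).mono_set Ioc_subset_Icc_self
  have hstep2 : ENNReal.ofReal (∫ t in (t₀ + 1)..T, ν * Ω t) =
      ∫⁻ t in Ioc (t₀ + 1) T, ENNReal.ofReal (ν * Ω t) := by
    rw [intervalIntegral.integral_of_le hTge]
    exact ofReal_integral_eq_lintegral_ofReal hint
      (ae_of_all _ fun t => mul_nonneg hν.le (negEnstrophy_nonneg L (u t) (v t)))
  -- (3) enlarge the time set and use the pointwise control by the dissipation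
  have hstep3 : ∫⁻ t in Ioc (t₀ + 1) T, ENNReal.ofReal (ν * Ω t) ≤
      ∫⁻ t in Ioc 1 T, ENNReal.ofReal (ν * Ω t) :=
    lintegral_mono_set (Ioc_subset_Ioc_left (by linarith))
  have hstep4 : ∫⁻ t in Ioc 1 T, ENNReal.ofReal (ν * Ω t) ≤
      2 * (ENNReal.ofReal L * ∫⁻ t in Ioc 1 T, layerDissipation ν L (u t) (v t)) := by
    calc ∫⁻ t in Ioc 1 T, ENNReal.ofReal (ν * Ω t)
        ≤ ∫⁻ t in Ioc 1 T, 2 * (ENNReal.ofReal L * layerDissipation ν L (u t) (v t)) :=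
          lintegral_mono fun t => ofReal_negEnstrophy_le hν.le hL (u t) (v t)
      _ = 2 * (ENNReal.ofReal L * ∫⁻ t in Ioc 1 T, layerDissipation ν L (u t) (v t)) := by
          rw [lintegral_const_mul' _ _ ENNReal.ofNat_ne_top, lintegral_const_mul' _ _ ENNReal.ofReal_ne_top]
  -- (4) assemble and divide by two
  have hall : 2 * ENNReal.ofReal ((L * (r / 4 * min L 1) - ε) * T) ≤
      2 * (ENNReal.ofReal L * ∫⁻ t in Ioc 1 T, layerDissipation ν L (u t) (v t)) := by
    calc 2 * ENNReal.ofReal ((L * (r / 4 * min L 1) - ε) * T)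
        = ENNReal.ofReal (2 * ((L * (r / 4 * min L 1) - ε) * T)) := by
          rw [ENNReal.ofReal_mul zero_le_two, ENNReal.ofReal_ofNat]
      _ ≤ ENNReal.ofReal (∫ t in (t₀ + 1)..T, ν * Ω t) := hstep1
      _ = ∫⁻ t in Ioc (t₀ + 1) T, ENNReal.ofReal (ν * Ω t) := hstep2
      _ ≤ ∫⁻ t in Ioc 1 T, ENNReal.ofReal (ν * Ω t) := hstep3
      _ ≤ 2 * (ENNReal.ofReal L * ∫⁻ t in Ioc 1 T, layerDissipation ν L (u t) (v t)) := hstep4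
  exact (ENNReal.mul_le_mul_iff_right two_ne_zero ENNReal.ofNat_ne_top).1 hall

end Summit.AnomalousDissipation.AnomalousDissipation.Theorems.StrainedLayerLaw.LogEnstrophyClock

end
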